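import Summits.BirchSwinnertonDyer.BirchSwinnertonDyer.Theorems.ErratumRoadFiveAuxPrimeSupply
import Summits.BirchSwinnertonDyer.BirchSwinnertonDyer.Theorems.ErratumRoadFiveAuxNormReceptacleDefs
import HarnessLib

/-!
# (C) `ChebotarevKummerSupply` — the generic Chebotarev–Kummer supply of the aux-norm line (v15 stub)

Helper file for crux `stmt-BirchSwinnertonDyer-19715`, line `aux_norm_receptacle` / skeleton v15 (LEAD bsd-line-er5-p1 g3,
`Theorems/ErratumRoadFiveAuxNormReceptacleDefs.lean`): proves the registered-to-be stub header
`stub_chebotarevKummerSupply : … → AuxNormReceptacle.ChebotarevKummerSupply W K p` (seat bsd-line-er5-p1-w2 g5, step F5).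
Sorry-free; nothing here closes 19715; no summit statement is proved; BSD is proved for no curve.

Proof: for `γ ∈ 𝓞_K ∖ {0}` with `N(γ) = r^p` and `γ ∉ K^{×p}`, the Kummer exclusion for `γ` holds
(`kummerExclusion_of_norm_eq_pow`: a `p`-th root of `eγ/γ₀(eγ) = (eγ)²/r^p` fixed by
`res Γ_K ∩ Stab ζ ∩ ker ρ̄_{E,p}` descends (F3b-2) to `δ ∈ K` with `(δ r)^p = γ²`, whence `γ = (γ (δ r)^{-m})^p`,
`p = 2m + 1`); the witness `γ₁ = γ₀ a` of F3a and the Chebotarev step F2 give `ℓ₀ ∉ T ∪ primeFactors N(γ𝓞_K)` inert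
with `p^E ∣ ℓ₀ + 1`, `p ∤ a_{ℓ₀}`, `γ^{(ℓ₀²-1)/p} ≢ 1 (mod ℓ₀)`; as `γ ∉ ℓ₀𝓞_K`, a `p`-th root `y` of `γ mod ℓ₀` would give
`γ^{(ℓ₀²-1)/p} ≡ y^{ℓ₀²-1} ≡ 1` (`RingClass.pow_sub_one_mem_span_of_inert`).

References: B. H. Gross, LMS LNS 153 (1991), §3, §9 [GrossLMS1991]; D. A. Cox, *Primes of the form x² + ny²* (2013), §7.D, Thm. 8.12 [Cox2013].
-/

noncomputable section

set_option linter.dupNamespace false -- `Summit.BirchSwinnertonDyer.BirchSwinnertonDyer` (summit = problem), tree-wide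

open scoped Classical NumberField Pointwise nonZeroDivisors
open WeierstrassCurve NumberField Field IsDedekindDomain
open Literature.NumberTheory.GaloisRepresentations Literature.NumberTheory.EllipticCurves
open Literature.NumberTheory.NumberFields.RingClassField Literature.NumberTheory.QuadraticFields

namespace Summit.BirchSwinnertonDyer.BirchSwinnertonDyer.Theorems

namespace AuxPrimeSupply

/-- In a field, if `γ² = t^p` with `p` odd then `γ` is a `p`-th power (`γ = (γ t^{-m})^p`, `p = 2m+1`). [folklore] -/
theorem exists_pow_eq_of_sq_eq_pow {F : Type*} [Field F] {p : ℕ} (hp : Odd p) {γ t : F} (hγ : γ ≠ 0)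
    (h : t ^ p = γ ^ 2) : ∃ y : F, y ^ p = γ := by
  obtain ⟨m, hm⟩ := hp
  have ht : t ≠ 0 := by
    intro h0
    rw [h0, zero_pow (by omega)] at h
    exact pow_ne_zero 2 hγ h.symm
  refine ⟨γ * (t ^ m)⁻¹, ?_⟩
  rw [mul_pow, inv_pow, ← pow_mul, mul_comm m p, pow_mul, h, ← pow_mul]
  rw [hm, pow_succ, show 2 * m = 2 * m from rfl]
  field_simp

/-- **The Kummer exclusion for a generic `γ`.** `K` quadratic, `p ≥ 5`, `ρ̄_{E,p}` onto, `ζ` primitive of order `p^E`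
(`E ≥ 1`), `e` the embedding with fixed field `K`, `γ₀ ∉ res Γ_K`; `γ ∈ K^×` with `N(γ) = r^p` and `γ ∉ K^{×p}`.  Then no
`p`-th root of `eγ/γ₀(eγ)` is fixed by `res Γ_K ∩ Stab ζ ∩ ker ρ̄_{E,p}`. [cite: GrossLMS1991, §9 (Kummer theory in the proof of Prop. 9.5)] -/
theorem kummerExclusion_of_norm_eq_pow (W : WeierstrassCurve ℚ) [W.IsElliptic] {K : Type} [Field K]
    [NumberField K] (hK2 : Module.finrank ℚ K = 2) {p : ℕ} [Fact p.Prime] (hp5 : 5 ≤ p)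
    (hsurj : W.HasSurjectiveModNGaloisRep p) {E : ℕ} [NeZero (p ^ E)] (hE : 1 ≤ E)
    {ζ : AlgebraicClosure ℚ} (hζ : IsPrimitiveRoot ζ (p ^ E)) (e : K →ₐ[ℚ] AlgebraicClosure ℚ)
    (he : ∀ g : absoluteGaloisGroup ℚ, g ∈ (absGaloisRestrict ℚ K).range ↔ ∀ k : K, g • e k = e k)
    {γ₀ : absoluteGaloisGroup ℚ} (hγ₀ : γ₀ ∉ (absGaloisRestrict ℚ K).range)
    {γ : K} (hγ0 : γ ≠ 0) {r : ℚ} (hN : Algebra.norm ℚ γ = r ^ p) (hnot : ∀ y : K, y ^ p ≠ γ) :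
    ∀ y : AlgebraicClosure ℚ, y ^ p = e γ * (γ₀ • e γ)⁻¹ →
      ∃ a : absoluteGaloisGroup ℚ, a ∈ (absGaloisRestrict ℚ K).range ∧ a • ζ = ζ ∧
        galoisRepTorsion W p a = 1 ∧ a • y ≠ y := by
  have hp : p.Prime := Fact.out
  have hp2 : p ≠ 2 := by omega
  have hpodd : Odd p := hp.odd_of_ne_two hp2
  haveI : Algebra.IsQuadraticExtension ℚ K := ⟨hK2⟩
  set H := (absGaloisRestrict ℚ K).range with hH
  have hHi : H.index = 2 := (index_range_absGaloisRestrict_eq_finrank ℚ K).trans hK2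
  haveI hHn : H.Normal := Subgroup.normal_of_index_eq_two hHi
  intro y hyp
  by_contra hcon
  simp only [not_exists, not_and, not_not] at hcon
  set x := e γ * (γ₀ • e γ)⁻¹ with hx
  have hfix : ∀ g ∈ H, g • e γ = e γ := fun g hg ↦ (he g).mp hg γ
  have hfix' : ∀ g ∈ H, g • (γ₀ • e γ) = γ₀ • e γ := fun g hg ↦ by
    have hmem : γ₀⁻¹ * g * γ₀ ∈ H := hHn.conj_mem' g hg γ₀
    calc g • (γ₀ • e γ) = γ₀ • ((γ₀⁻¹ * g * γ₀) • e γ) := by rw [mul_smul, mul_smul, smul_inv_smul]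
      _ = γ₀ • e γ := by rw [hfix _ hmem]
  have hxfix : ∀ g ∈ H, g • x = x := fun g hg ↦ by
    rw [hx, smul_mul', smul_inv'', hfix g hg, hfix' g hg]
  have hy1 : ∀ g ∈ H, g • ζ = ζ → g • y = y :=
    smul_eq_of_fixed_by_ker_galoisRep W hK2 hp5 hsurj hE hζ hxfix hyp
      (fun g hg hζg hρ ↦ hcon g hg hζg hρ)
  obtain ⟨y₀, hy₀p, hy₀⟩ := exists_fixed_root_of_fixed_by_stabilizer hK2 hp5 hE hζ e he hxfix hyp hy1
  obtain ⟨δ, hδ⟩ := exists_eq_embedding_of_forall_smul e he hy₀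
  have hnorm := embedding_mul_smul_eq_norm hK2 e he hγ₀ γ
  have heγ0 : e γ ≠ 0 := by rw [map_ne_zero_iff e e.injective]; exact hγ0
  have hγγ0 : γ₀ • e γ ≠ 0 := by rw [Ne, smul_eq_zero_iff_eq]; exact heγ0
  -- `(δ · r)^p = γ²`
  have hK' : e ((δ * algebraMap ℚ K r) ^ p) = e (γ ^ 2) := by
    rw [map_pow, map_mul, hδ, AlgHom.commutes, mul_pow, hy₀p, ← map_pow, ← hN, ← hnorm, hx, map_pow]
    field_simp
  have hK : (δ * algebraMap ℚ K r) ^ p = γ ^ 2 := e.injective hK'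
  obtain ⟨y', hy'⟩ := exists_pow_eq_of_sq_eq_pow hpodd hγ0 hK
  exact hnot y' hy'

end AuxPrimeSupply

/-! ### The v15 stub (C) -/

/-- **(C) `ChebotarevKummerSupply W K p`** — the v15 stub header of LEAD bsd-line-er5-p1 g3 (HOME STATUS 15:15:19Z),
proved: for every `E`, finite `T`, `γ ∈ 𝓞_K ∖ {0}` with `N(γ) = r^p` and `γ ∉ K^{×p}`, a prime `ℓ₀ ∉ T`, inert in `K`,
with `p ∤ a_{ℓ₀}(W)`, `p^E ∣ ℓ₀ + 1`, and `γ` not a `p`-th power modulo `ℓ₀𝓞_K`.  Assembly of F2 (`exists_auxPrime_of_frobeniusWitness`),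
F3a (`exists_preWitness`, `exists_witness_of_kummerExclusion`), F3b-2 (descent) via `kummerExclusion_of_norm_eq_pow`, and the
residue conversion through `RingClass.pow_sub_one_mem_span_of_inert`. [cite: Cox2013, Thm. 8.12 (Chebotarev), §7.D (7.27)] [cite: GrossLMS1991, §3 (p. 239)] -/
theorem stub_chebotarevKummerSupply (W : WeierstrassCurve ℚ) [W.IsElliptic] [W.IsGloballyMinimal]
    (K : Type) [Field K] [NumberField K] (hK : Literature.NumberTheory.EllipticCurves.IsImaginaryQuadratic K)
    (hdK : NumberField.discr K < -4) (p : ℕ) [Fact p.Prime] (hp5 : 5 ≤ p)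
    (hsurj : W.HasSurjectiveModNGaloisRep p) :
    Summit.BirchSwinnertonDyer.BirchSwinnertonDyer.Theorems.AuxNormReceptacle.ChebotarevKummerSupply W K p := by
  classical
  -- `hdK` (part of the registered header) is not needed for (C); reference it to keep the header verbatim.
  have _hdK := hdK
  intro E T γ r hγ0 hNr hnot
  have hp : p.Prime := Fact.out
  have hK2 := hK.1
  haveI : Algebra.IsQuadraticExtension ℚ K := ⟨hK2⟩
  set E' := max E 1 with hE'
  have hE'1 : 1 ≤ E' := le_max_right _ _
  have hEE' : p ^ E ∣ p ^ E' := pow_dvd_pow p (le_max_left _ _)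
  haveI : NeZero (p ^ E') := ⟨pow_ne_zero _ hp.ne_zero⟩
  obtain ⟨ζ, hζ⟩ := HasEnoughRootsOfUnity.exists_primitiveRoot (AlgebraicClosure ℚ) (p ^ E')
  obtain ⟨e, he⟩ := exists_mem_range_absGaloisRestrict_iff ℚ K
  have hγK0 : (γ : K) ≠ 0 := by rw [Ne, RingOfIntegers.coe_eq_zero_iff]; exact hγ0
  -- the witness
  obtain ⟨γ₀, hγ₀H, hγ₀ζ, hγ₀tr⟩ := AuxPrimeSupply.exists_preWitness W hK hp5 hsurj hE'1 hζ
  obtain ⟨α, hα⟩ := IsAlgClosed.exists_pow_nat_eq (e (γ : K)) hp.pos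
  have hα0 : α ≠ 0 := by
    intro h0
    have : e (γ : K) = 0 := by rw [← hα, h0, zero_pow hp.ne_zero]
    rw [map_eq_zero_iff e e.injective] at this
    exact hγK0 this
  have hKEX := AuxPrimeSupply.kummerExclusion_of_norm_eq_pow W hK2 hp5 hsurj hE'1 hζ e he hγ₀H hγK0
    hNr hnot
  obtain ⟨γ₁, hγ₁H, hγ₁ζ, hγ₁tr, hγ₁α⟩ :=
    AuxPrimeSupply.exists_witness_of_kummerExclusion W hK hE'1 e hζ hα hα0 hγ₀H hγ₀ζ hγ₀tr hKEX
  -- the auxiliary prime, outside `T ∪ primeFactors N(γ𝓞_K)`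
  set n₀ := Ideal.absNorm (Ideal.span {γ}) with hn₀
  have hn₀0 : n₀ ≠ 0 := by
    rw [hn₀, Ne, Ideal.absNorm_eq_zero_iff, Ideal.span_singleton_eq_bot]; exact hγ0
  obtain ⟨ℓ₀, hℓ₀, hℓ₀T, hinert, hpE, haℓ, hkum⟩ :=
    AuxPrimeSupply.exists_auxPrime_of_frobeniusWitness W hK hE'1 e hζ hα hγ₁H hγ₁ζ hγ₁tr hγ₁α
      (T ∪ n₀.primeFactors)
  simp only [Finset.mem_union, Nat.mem_primeFactors, not_or] at hℓ₀T
  obtain ⟨hℓ₀T', hℓ₀n⟩ := hℓ₀T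
  have hℓ₀n' : ¬ ℓ₀ ∣ n₀ := fun hd ↦ hℓ₀n ⟨hℓ₀, hd, hn₀0⟩
  refine ⟨ℓ₀, hℓ₀, hℓ₀T', hinert, haℓ, hEE'.trans hpE, ?_⟩
  -- `γ ∉ ℓ₀𝓞_K`
  have hℓne : Ideal.span {(ℓ₀ : 𝓞 K)} ≠ ⊥ := by
    rw [Ne, Ideal.span_singleton_eq_bot]; exact_mod_cast hℓ₀.ne_zero
  haveI hmax : (Ideal.span {(ℓ₀ : 𝓞 K)}).IsMaximal := hinert.isMaximal hℓne
  have hγℓ : γ ∉ Ideal.span {(ℓ₀ : 𝓞 K)} := by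
    intro hmem
    have hle : Ideal.span {γ} ≤ Ideal.span {(ℓ₀ : 𝓞 K)} := (Ideal.span_singleton_le_iff_mem _).mpr hmem
    have hdvd := Ideal.absNorm_dvd_absNorm_of_le hle
    rw [← hn₀] at hdvd
    have hℓ2 : Ideal.absNorm (Ideal.span {(ℓ₀ : 𝓞 K)}) = ℓ₀ ^ 2 := by
      rw [Ideal.absNorm_apply, Submodule.cardQuot_apply, RingClass.natCard_quot_span_natCast hK2]
    rw [hℓ2] at hdvd
    exact hℓ₀n' ((dvd_pow_self ℓ₀ two_ne_zero).trans hdvd)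
  -- a `p`-th root of `γ mod ℓ₀` would make `γ^{(ℓ₀²-1)/p} ≡ 1`
  rintro ⟨y, hy⟩
  have hyℓ : y ∉ Ideal.span {(ℓ₀ : 𝓞 K)} := by
    intro hmem
    apply hγℓ
    have : γ = y ^ p - (y ^ p - γ) := by ring
    rw [this]
    exact Submodule.sub_mem _ (Ideal.pow_mem_of_mem _ hmem p hp.pos) hy
  have hycop : Ideal.span {y} ⊔ Ideal.span {(ℓ₀ : 𝓞 K)} = ⊤ := by
    by_contra hne
    have hle : Ideal.span {(ℓ₀ : 𝓞 K)} ≤ Ideal.span {y} ⊔ Ideal.span {(ℓ₀ : 𝓞 K)} := le_sup_right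
    have heq := hmax.eq_of_le hne hle
    apply hyℓ
    rw [heq]
    exact Ideal.mem_sup_left (Ideal.mem_span_singleton_self y)
  have hF := RingClass.pow_sub_one_mem_span_of_inert hK2 hℓ₀ hinert hycop
  -- `p k = ℓ₀² - 1`
  have hsq : ℓ₀ ^ 2 - 1 = (ℓ₀ + 1) * (ℓ₀ - 1) := by
    obtain ⟨k, rfl⟩ : ∃ k, ℓ₀ = k + 1 := ⟨ℓ₀ - 1, (Nat.sub_add_cancel hℓ₀.one_le).symm⟩
    rw [Nat.add_sub_cancel]
    exact Nat.sub_eq_of_eq_add (by ring)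
  have hpdvd : p ∣ ℓ₀ ^ 2 - 1 := by
    rw [hsq]; exact ((dvd_pow_self p (by omega : E' ≠ 0)).trans hpE).mul_right _
  obtain ⟨k, hk⟩ := hpdvd
  have hkdiv : (ℓ₀ ^ 2 - 1) / p = k := by rw [hk, Nat.mul_div_cancel_left _ hp.pos]
  apply hkum
  rw [hkdiv]
  have h1 : Ideal.Quotient.mk (Ideal.span {(ℓ₀ : 𝓞 K)}) γ =
      Ideal.Quotient.mk (Ideal.span {(ℓ₀ : 𝓞 K)}) y ^ p := by
    rw [← map_pow, eq_comm, Ideal.Quotient.eq]; exact hy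
  have h2 : Ideal.Quotient.mk (Ideal.span {(ℓ₀ : 𝓞 K)}) y ^ (ℓ₀ ^ 2 - 1) = 1 := by
    have := (Ideal.Quotient.eq (I := Ideal.span {(ℓ₀ : 𝓞 K)})).mpr hF
    rwa [map_pow, map_one] at this
  rw [← Ideal.Quotient.eq, map_pow, map_one, h1, ← pow_mul, ← hk, h2]

end Summit.BirchSwinnertonDyer.BirchSwinnertonDyer.Theorems

end
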